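import Summits.BirchSwinnertonDyer.BirchSwinnertonDyer.Theorems.AdditiveKolyvaginRoadLevelSystemsRigidityConnected
import Summits.BirchSwinnertonDyer.BirchSwinnertonDyer.Theorems.AdditiveKolyvaginRoadLevelSystemsOfIgnition
import HarnessLib

/-!
# Route `AdditiveKolyvaginRoad`, crux `LevelKolyvaginSystemsAdditive` (item stmt-BirchSwinnertonDyer-21396, KS′):
# the carrier's core graph is CONNECTED at a ♯ additive frame, modulo witness-free ONE-PRIME RAISING and odd bottom rank
# — the dichotomy inputs (Inert) ∕ (Lower) ∕ (Cheb) DISCHARGED in the kernel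
# (cell `pub/bsd-wall`, width seat `bsd-wall-akr-p2x-w2` g2; `--supports stmt-BirchSwinnertonDyer-21396`, helper; part 5, after the
# abstract parts 4a/4b `…LevelSystemsRigidityDichotomy` ∕ `…LevelSystemsRigidityConnected` and the carrier parts 1–3)

WHAT. The abstract connectivity theorem `CoreGraph.connected_of_dichotomy` (Howard 2006 Lemma 2.4.9 ∕ 2.4.10 ∕ Prop. 2.4.11
over a field with two signs) instantiated for the canonical spaces `SelQP W K p c` in `H¹(K, E[p])`, «locally trivial above
`q`» = «in `torsionLocalKer` at every place above `q`», and the SIGN `ε_q` of a Bertolini–Darmon admissible prime = the scalar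
by which complex conjugation acts on `H¹(K_q, E[p])` ((Equiv), W. Zhang (9.2), akr-p1's `localEquiv_of_admQ`). Discharged:
* §1 (Lower) AT A GIVEN DETECTED PRIME, Poitou–Tate-FREE — `selQP_lower_of_detected`: for `q ∉ n` and a class
  `x ∈ Sel_n^μ` with `loc_v x ≠ 0` at the place `v ∣ q`: `Sel_{n∪q}^μ ≤ Sel_n^μ` of codimension EXACTLY one, every class of
  `Sel_{n∪q}^μ` locally trivial above `q`, and `Sel_{n∪q}^{¬μ} = Sel_n^{¬μ}`. This is akr-p1 g0's
  `selQP_rankLowering_of_localGlobal` (W. Zhang Prop. 5.4: (Equiv) + (Line) + (Trans) + (Iso), all LANDED: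
  `localEquiv_of_admQ`, `localLine_of_admQ`, `localTrans_of_admQ`, `hiso_of_admQ`) with the Čebotarev CHOICE of `q` removed
  — the prime is an INPUT, which is what connectivity needs (Howard removes and re-adds GIVEN primes).
* §2 (Inert) + signed (Cheb) + the instantiation — `selQP_coreConnected`: at a ♯ additive frame (`p ≥ 5`, `Addv W p`, `ρ̄`
  onto, `K` imaginary quadratic Heegner for `N_E`, `c ≠ 1`), GIVEN (R′) witness-free one-prime RAISING («if every class of
  `Sel_m^μ` is locally trivial above a new `q` of sign `μ` then `dim Sel_{m∪q}^μ = dim Sel_m^μ + 1`» — W. Zhang Lemma 5.3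
  raising half; the tree's (R) `selQP_raise_of_admQ` is this modulo `poitouTate_selmerStructure_duality` plus a Kummer witness
  pinning the sign, here pinned by (Equiv) instead) and ODD total canonical rank at the bottom level (`dim_{𝔽_p} Sel_p(E/K)`
  odd; at `#Sel_p(E/K) = p` it is `1`, `finrank_selQP_empty_add_eq_one_iff`): every non-empty even level of canonical rank one
  is joined to any core level through core edges — the `connected` binder of part 3.
* §3 `nonempty_levelKolyvaginSystemP_of_bipartite_of_seed_at_frame`: KS′'s conclusion at a ♯ frame from a bipartite datum
  (two-sided laws), `selmer_bottom`, ONE SEED AT A CORE LEVEL, (R′) and odd bottom rank — the anchor (γ) at every odd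
  level of w2's dictionary and the `connected` binder of part 3 both GONE; what remains E-side is (R′) (Poitou–Tate) and the
  parity of `dim Sel_p(E/K)`.

HONEST FRAMING: theorems only; 0 definitions, 0 named facts, 0 `sorry`; (R′), odd bottom rank, the bipartite datum, the laws
and the seed are HYPOTHESES; CONDITIONAL; closes nothing. BSD is not proved by any of this.

References: [cite: Howard2006Bipartite, Lemma 2.4.9, Lemma 2.4.10, Prop. 2.4.11, Thm. 2.5.1] [cite: WZhang2014, Lemma 5.3,
Prop. 5.4, Lemma 7.3, Thm. 7.2, §9 (9.1)–(9.3)] [cite: BertoliniDarmon2005, Lemma 2.6, Thm. 3.2, Thm. 4.1, Thm. 4.2].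
-/

-- single-conjunct summit: `Summit.BirchSwinnertonDyer.BirchSwinnertonDyer.…` repeats the name by design
set_option linter.dupNamespace false

noncomputable section

open scoped Classical

namespace Summit.BirchSwinnertonDyer.BirchSwinnertonDyer.Theorems.AdditiveKoly

open WeierstrassCurve NumberField IsDedekindDomain
  Literature.NumberTheory.EllipticCurves Literature.NumberTheory.EllipticCurves.ModularForms
  Literature.NumberTheory.EllipticCurves.Rank1Residual Literature.NumberTheory.GaloisRepresentations Module
  Summit.BirchSwinnertonDyer.Rank1Residual.X11b.Three.Koly

variable (W : WeierstrassCurve ℚ) (K : Type) [Field K] [NumberField K] (p : ℕ) [W.IsElliptic] [W.IsGloballyMinimal]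
  [Fact p.Prime] (c : K ≃ₐ[ℚ] K) [Module (ZMod p) (Vp W K p)]

/-! ## §1 (Lower) at a GIVEN detected admissible prime, Poitou–Tate-free -/

omit [W.IsElliptic] [W.IsGloballyMinimal] [Fact p.Prime] [Module (ZMod p) (Vp W K p)] in
/-- **A `(¬s)`-eigenclass is locally trivial above an admissible prime of sign `s`** (W. Zhang (9.2), `p` odd): if complex
conjugation acts on `H¹(K_v, E[p])` by `sgnP s` (equivariantly for `loc_v`) and `c·y = sgnP (¬s) · y`, then `loc_v y = 0`.
[cite: WZhang2014, §9 (9.2)] -/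
theorem mem_torsionLocalKer_of_localSign_ne (hp : Odd p) {s : Bool} {v : HeightOneSpectrum (𝓞 K)}
    (hsv : ∀ z : Vp W K p, (W.baseChange K).torsionLocMap (v.adicCompletion K) ((p ^ 1 : ℕ) : ℤ)
      (conjAct W c ((p ^ 1 : ℕ) : ℤ) z) = sgnP s • (W.baseChange K).torsionLocMap (v.adicCompletion K) ((p ^ 1 : ℕ) : ℤ) z)
    {y : Vp W K p} (hy : conjAct W c ((p ^ 1 : ℕ) : ℤ) y = sgnP (!s) • y) :
    y ∈ (W.baseChange K).torsionLocalKer (v.adicCompletion K) ((p ^ 1 : ℕ) : ℤ) := by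
  have hNodd : Odd (((p ^ 1 : ℕ) : ℤ)) := by
    rw [pow_one]
    exact_mod_cast hp
  exact AddMonoidHom.mem_ker.mpr (loc_eq_zero_of_sign_ne_odd (conjAct W c _) _ hsv hy
    (by cases s <;> decide) hNodd (zsmul_discreteH1_torsion ((p ^ 1 : ℕ) : ℤ) _))

/-- **(Lower) AT A GIVEN DETECTED PRIME** (W. Zhang Prop. 5.4 for the canonical spaces, Poitou–Tate-FREE): `K` imaginary
quadratic, `p` odd, `c ≠ 1`; `q ∉ n` admissible with place `v`, `x ∈ Sel_n^μ` with `loc_v x ≠ 0`. THEN `Sel_{n∪q}^μ ≤ Sel_n^μ`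
with `dim Sel_{n∪q}^μ + 1 = dim Sel_n^μ`, every class of `Sel_{n∪q}^μ` is locally trivial above `q`, and
`Sel_{n∪q}^{¬μ} = Sel_n^{¬μ}`. Proof = akr-p1 g0's `selQP_rankLowering_of_localGlobal` with the prime GIVEN instead of chosen:
(Equiv) forces `ε_q = μ` and kills the `(¬μ)`-side at `v`; the one-prime step `selQP_insert_inf_kummer_eq` + (Iso) + (Trans) give
`Sel_{n∪q}^μ = Sel_n^μ ∩ ker loc_v`; rank–nullity against the Kummer line (Line). [cite: WZhang2014, Prop. 5.4, §9 (9.1)–(9.3)]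
[cite: BertoliniDarmon2005, Lemma 2.6] -/
theorem selQP_lower_of_detected (hK : IsImaginaryQuadratic K) (hp : Odd p) (hc1 : c ≠ 1)
    {n : Finset (AdmQ W K p)} {q : AdmQ W K p} (hqn : q ∉ n) {μ : Bool} {x : Vp W K p}
    (hx : x ∈ SelQP W K p c n μ) {v : HeightOneSpectrum (𝓞 K)} (hv : ((q : ℕ) : 𝓞 K) ∈ v.asIdeal)
    (hvx : (W.baseChange K).torsionLocMap (v.adicCompletion K) ((p ^ 1 : ℕ) : ℤ) x ≠ 0) :
    SelQP W K p c (insert q n) μ ≤ SelQP W K p c n μ ∧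
      finrank (ZMod p) (SelQP W K p c (insert q n) μ) + 1 = finrank (ZMod p) (SelQP W K p c n μ) ∧
      (∀ y ∈ SelQP W K p c (insert q n) μ, ∀ v' : HeightOneSpectrum (𝓞 K), ((q : ℕ) : 𝓞 K) ∈ v'.asIdeal →
        y ∈ (W.baseChange K).torsionLocalKer (v'.adicCompletion K) ((p ^ 1 : ℕ) : ℤ)) ∧
      SelQP W K p c (insert q n) (!μ) = SelQP W K p c n (!μ) := by
  have hline := localLine_of_admQ W K p hK.1
  have htrans := localTrans_of_admQ W K p
  have hiso := hiso_of_admQ W K p c hK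
  set loc := (W.baseChange K).torsionLocMap (v.adicCompletion K) ((p ^ 1 : ℕ) : ℤ) with hloc
  -- the place above the inert prime q is unique
  have hq0 : (q : ℕ) ≠ 0 := q.2.1.ne_zero
  have hqP : (Ideal.span {((q : ℕ) : 𝓞 K)}).IsPrime := q.2.2.2.1
  have huniq : ∀ v' : HeightOneSpectrum (𝓞 K), ((q : ℕ) : 𝓞 K) ∈ v'.asIdeal → v' = v :=
    fun v' hv' ↦ Method2.placesAbove_eq_of_isPrime_span K hqP hq0 hv hv'
  have hNodd : Odd (((p ^ 1 : ℕ) : ℤ)) := by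
    rw [pow_one]
    exact_mod_cast hp
  have hNloc : ∀ z : Vp W K p, ((p ^ 1 : ℕ) : ℤ) • loc z = 0 := fun z ↦
    zsmul_discreteH1_torsion ((p ^ 1 : ℕ) : ℤ) (loc z)
  -- (Equiv): the sign of q is forced to be μ
  obtain ⟨s, hs⟩ := localEquiv_of_admQ W K p hK.1 hc1 q
  have hsv : ∀ z : Vp W K p, loc (conjAct W c ((p ^ 1 : ℕ) : ℤ) z) = sgnP s • loc z := hs v hv
  have hsμ : s = μ := by
    by_contra hne
    exact hvx (loc_eq_zero_of_sign_ne_odd (conjAct W c _) loc hsv (conjAct_eq_of_mem_selQP W K p c n μ hx) hne hNodd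
      (hNloc x))
  -- hence loc kills every (¬μ)-eigenclass
  have hkill : ∀ (m : Finset (AdmQ W K p)) (y : Vp W K p), y ∈ SelQP W K p c m (!μ) → loc y = 0 :=
    fun m y hy ↦ loc_eq_zero_of_sign_ne_odd (conjAct W c _) loc hsv (conjAct_eq_of_mem_selQP W K p c m (!μ) hy)
      (by rw [hsμ]; cases μ <;> decide) hNodd (hNloc y)
  -- zero classes are Kummer and toric
  have hKumTor : ∀ y : Vp W K p, loc y = 0 →
      y ∈ selmerLocalKer (W.baseChange K) (v.adicCompletion K) ((p ^ 1 : ℕ) : ℤ) := fun y hy ↦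
    (W.baseChange K).torsionLocalKer_le_selmerLocalKer (v.adicCompletion K) _ (AddMonoidHom.mem_ker.mpr hy)
  have hOrdTor : ∀ y : Vp W K p, loc y = 0 →
      y ∈ toricLocalKer (W.baseChange K) (v.adicCompletion K) ((p ^ 1 : ℕ) : ℤ) := fun y hy ↦
    torsionLocalKer_le_toricLocalKer W K _ _ (AddMonoidHom.mem_ker.mpr hy)
  -- the one-prime step, in membership form at the unique place v
  have hstep : ∀ (ν : Bool) (y : Vp W K p),
      (y ∈ SelQP W K p c (insert q n) ν ∧ y ∈ selmerLocalKer (W.baseChange K) (v.adicCompletion K) ((p ^ 1 : ℕ) : ℤ)) ↔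
      (y ∈ SelQP W K p c n ν ∧ y ∈ toricLocalKer (W.baseChange K) (v.adicCompletion K) ((p ^ 1 : ℕ) : ℤ)) := by
    intro ν y
    have h' := SetLike.ext_iff.mp (selQP_insert_inf_kummer_eq W K p c n q hqn ν) y
    simp only [Submodule.mem_inf, AddSubgroup.mem_toZModSubmodule, AddSubgroup.mem_iInf] at h'
    constructor
    · rintro ⟨h1, h2⟩
      obtain ⟨h1', h2'⟩ := h'.mp ⟨h1, fun v' hv' ↦ by rw [huniq v' hv']; exact h2⟩
      exact ⟨h1', h2' v hv⟩
    · rintro ⟨h1, h2⟩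
      obtain ⟨h1', h2'⟩ := h'.mpr ⟨h1, fun v' hv' ↦ by rw [huniq v' hv']; exact h2⟩
      exact ⟨h1', h2' v hv⟩
  -- the kernel description on the μ-side
  have hker : ∀ y : Vp W K p, y ∈ SelQP W K p c (insert q n) μ ↔ (y ∈ SelQP W K p c n μ ∧ loc y = 0) := by
    intro y
    constructor
    · intro hy
      have hmono := selRelQP_mono W K p c (insert q n)
        (S := (∅ : Set (AdmQ W K p))) (S' := {q}) (Set.empty_subset _) μ
      rw [← selQP_eq_selRelQP_empty] at hmono
      have hyR : y ∈ SelRelQP W K p c (insert q n) {q} μ := hmono hy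
      have hxR : x ∈ SelRelQP W K p c (insert q n) {q} μ :=
        relaxationP_le W K p c n q {q} μ hqn (Set.mem_singleton q) hx
      have hy0 : loc y = 0 :=
        htrans q v hv x y (mem_selmerLocalKer_of_mem_selQP W K p c n q hqn v hv μ hx)
          (mem_toricLocalKer_of_mem_selQP_insert W K p c n q v hv μ hy) (hiso n q μ hqn v hv y hyR x hxR hvx)
      exact ⟨((hstep μ y).mp ⟨hy, hKumTor y hy0⟩).1, hy0⟩
    · rintro ⟨hy, hy0⟩
      exact ((hstep μ y).mpr ⟨hy, hOrdTor y hy0⟩).1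
  -- codimension exactly one: rank–nullity against the Kummer line, over ZMod p
  haveI : Module (ZMod p) (discreteH1 (Field.absoluteGaloisGroup (v.adicCompletion K))
      (AddSubgroup.torsionBy (localPoints (W.baseChange K) (v.adicCompletion K)) ((p ^ 1 : ℕ) : ℤ))) :=
    AddCommGroup.zmodModule (fun z ↦ by
      have h := zsmul_discreteH1_torsion ((p ^ 1 : ℕ) : ℤ) z
      rw [← natCast_zsmul]
      convert h using 2
      push_cast
      ring)
  set locZ := loc.toZModLinearMap p with hlocZ
  have hlocZ_apply : ∀ y : Vp W K p, locZ y = loc y := fun _ ↦ rfl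
  obtain ⟨ℓ, hℓ⟩ := hline q v hv
  haveI : FiniteDimensional (ZMod p) (SelQP W K p c n μ) := finiteDimensional_selQP W K p c n μ
  haveI : FiniteDimensional (ZMod p) (Submodule.span (ZMod p) ({ℓ} : Set _)) :=
    FiniteDimensional.span_of_finite (ZMod p) (Set.finite_singleton ℓ)
  have hfr : finrank (ZMod p) ↥(SelQP W K p c n μ ⊓ LinearMap.ker locZ) + 1 =
      finrank (ZMod p) (SelQP W K p c n μ) := by
    refine ZhangInduction.finrank_inf_ker_add_one_of_line (SelQP W K p c n μ) locZ (Submodule.span (ZMod p) {ℓ})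
      ((finrank_span_le_card _).trans (le_of_eq (by rw [Set.toFinset_card, Set.card_singleton]))) ?_
      ⟨x, hx, by rw [hlocZ_apply]; exact hvx⟩
    intro y hy
    obtain ⟨a, ha⟩ := hℓ y (mem_selmerLocalKer_of_mem_selQP W K p c n q hqn v hv μ hy)
    rw [Submodule.mem_span_singleton]
    exact ⟨(a : ZMod p), by rw [hlocZ_apply, ha, Int.cast_smul_eq_zsmul]⟩
  have heq : SelQP W K p c (insert q n) μ = SelQP W K p c n μ ⊓ LinearMap.ker locZ := by
    ext y
    rw [Submodule.mem_inf, LinearMap.mem_ker, hlocZ_apply]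
    exact hker y
  refine ⟨fun y hy ↦ ((hker y).mp hy).1, by rw [heq]; exact hfr, fun y hy v' hv' ↦ ?_, ?_⟩
  · rw [huniq v' hv']
    exact AddMonoidHom.mem_ker.mpr ((hker y).mp hy).2
  · -- the (¬μ)-side is untouched
    ext y
    constructor
    · intro hy
      exact ((hstep (!μ) y).mp ⟨hy, hKumTor y (hkill _ y hy)⟩).1
    · intro hy
      exact ((hstep (!μ) y).mpr ⟨hy, hOrdTor y (hkill _ y hy)⟩).1


/-! ## §2 Connectivity of the carrier's core graph at a ♯ additive frame, modulo (R′) and odd bottom rank -/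

section Connected

/-- **THE CARRIER'S CORE GRAPH IS CONNECTED at a ♯ additive frame, modulo witness-free ONE-PRIME RAISING (R′) and ODD
bottom rank.** At `p ≥ 5` additive with `ρ̄_{E,p}` onto, `K` imaginary quadratic with the Heegner hypothesis for `N_E`, `c ≠ 1`:
GIVEN (R′) — for `q ∉ m` admissible of sign `μ` (complex conjugation acts on `H¹(K_v, E[p])` by `sgnP μ`, `v ∣ q`), if every
class of `Sel_m^μ` is locally trivial above `q` then `Sel_m^μ ≤ Sel_{m∪q}^μ` with `dim Sel_{m∪q}^μ = dim Sel_m^μ + 1` (W. Zhang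
Lemma 5.3, raising half; Poitou–Tate) — and `dim Sel_∅⁺ + dim Sel_∅⁻` ODD: every non-empty even level of canonical rank one is
joined to any level `n₀` of total rank `≤ 1` through core edges (`b = a ∪ {q}`, the odd end having `Sel^± = 0`). The other
inputs of Howard's Prop. 2.4.11 are DISCHARGED here: the sign `ε_q` by (Equiv) `localEquiv_of_admQ`, (Inert) by (9.2)
(`mem_torsionLocalKer_of_localSign_ne` + `selQP_insert_eq_of_forall_mem_torsionLocalKer`), (Lower) at a given prime by
`selQP_lower_of_detected`, signed (Cheb) by `exists_admQ_notMem_torsionLocalKer`, bookkeeping and finiteness by parts 1–2 and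
`finiteDimensional_selQP`. [cite: Howard2006Bipartite, Prop. 2.4.11] [cite: WZhang2014, Lemma 5.3, Prop. 5.4, Lemma 7.3, §9] -/
theorem selQP_coreConnected (h5 : 5 ≤ p) (hadd : Addv W p) (hsurj : W.HasSurjectiveModNGaloisRep p)
    (hK : IsImaginaryQuadratic K) (hH : SatisfiesHeegnerHypothesis (W.conductorNorm ℤ) K) (hc1 : c ≠ 1)
    (hraise : ∀ (m : Finset (AdmQ W K p)) (q : AdmQ W K p) (μ : Bool), q ∉ m →
      (∀ v : HeightOneSpectrum (𝓞 K), ((q : ℕ) : 𝓞 K) ∈ v.asIdeal → ∀ z : Vp W K p,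
        (W.baseChange K).torsionLocMap (v.adicCompletion K) ((p ^ 1 : ℕ) : ℤ) (conjAct W c ((p ^ 1 : ℕ) : ℤ) z) =
          sgnP μ • (W.baseChange K).torsionLocMap (v.adicCompletion K) ((p ^ 1 : ℕ) : ℤ) z) →
      (∀ x ∈ SelQP W K p c m μ, ∀ v : HeightOneSpectrum (𝓞 K), ((q : ℕ) : 𝓞 K) ∈ v.asIdeal →
        x ∈ (W.baseChange K).torsionLocalKer (v.adicCompletion K) ((p ^ 1 : ℕ) : ℤ)) →
      SelQP W K p c m μ ≤ SelQP W K p c (insert q m) μ ∧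
        finrank (ZMod p) (SelQP W K p c (insert q m) μ) = finrank (ZMod p) (SelQP W K p c m μ) + 1)
    (hodd : Odd (finrank (ZMod p) (SelQP W K p c ∅ true) + finrank (ZMod p) (SelQP W K p c ∅ false)))
    {n₀ : Finset (AdmQ W K p)}
    (hn₀ : finrank (ZMod p) (SelQP W K p c n₀ true) + finrank (ZMod p) (SelQP W K p c n₀ false) ≤ 1) :
    ∀ n : Finset (AdmQ W K p), n.Nonempty → Even n.card →
      finrank (ZMod p) (SelQP W K p c n true) + finrank (ZMod p) (SelQP W K p c n false) = 1 →
      Relation.EqvGen (fun a b : Finset (AdmQ W K p) ↦ ∃ q, q ∉ a ∧ b = insert q a ∧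
        (Even a.card → SelQP W K p c (insert q a) true = ⊥ ∧ SelQP W K p c (insert q a) false = ⊥) ∧
        (Odd a.card → SelQP W K p c a true = ⊥ ∧ SelQP W K p c a false = ⊥)) n₀ n := by
  have hp : Odd p := (Fact.out : p.Prime).odd_of_ne_two (by omega)
  -- the sign of each admissible prime, by (Equiv)
  choose ε hε using localEquiv_of_admQ W K p hK.1 hc1
  -- (9.2): a `(¬ε q)`-eigenclass is locally trivial above `q`
  have hInertT : ∀ (q : AdmQ W K p) (y : Vp W K p), conjAct W c ((p ^ 1 : ℕ) : ℤ) y = sgnP (!ε q) • y →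
      ∀ v : HeightOneSpectrum (𝓞 K), ((q : ℕ) : 𝓞 K) ∈ v.asIdeal →
        y ∈ (W.baseChange K).torsionLocalKer (v.adicCompletion K) ((p ^ 1 : ℕ) : ℤ) :=
    fun q y hy v hv ↦ mem_torsionLocalKer_of_localSign_ne W K p c hp (hε q v hv) hy
  refine CoreGraph.connected_of_dichotomy (SelQP W K p c)
    (fun (q : AdmQ W K p) (y : Vp W K p) ↦ ∀ v : HeightOneSpectrum (𝓞 K), ((q : ℕ) : 𝓞 K) ∈ v.asIdeal →
      y ∈ (W.baseChange K).torsionLocalKer (v.adicCompletion K) ((p ^ 1 : ℕ) : ℤ)) ε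
    (fun m μ ↦ finiteDimensional_selQP W K p c m μ)
    (fun _ _ _ _ hqn hy hT ↦ mem_selQP_insert_of_forall_mem_torsionLocalKer W K p c hqn hy hT)
    (fun _ _ _ _ _ hz hT ↦ mem_selQP_of_mem_selQP_insert_of_forall_mem_torsionLocalKer W K p c hz hT)
    (fun m q hqm ↦ selQP_insert_eq_of_forall_mem_torsionLocalKer W K p c m q hqm (!ε q) (hInertT q))
    (fun m q y hy ↦ hInertT q y (conjAct_eq_of_mem_selQP W K p c m (!ε q) hy))
    (fun m q hqm hx ↦ ?_) (fun m q hqm hx ↦ hraise m q (ε q) hqm (hε q) hx) (fun B m μ x hx hx0 ↦ ?_) hodd hn₀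
  · -- (Lower) at the given detected prime, Poitou–Tate-free (§1)
    obtain ⟨x, hx, hTx⟩ := hx
    obtain ⟨v, hv, hxv⟩ := (not_forall_mem_torsionLocalKer_iff W K p).mp hTx
    have hvx : (W.baseChange K).torsionLocMap (v.adicCompletion K) ((p ^ 1 : ℕ) : ℤ) x ≠ 0 :=
      fun h ↦ hxv (AddMonoidHom.mem_ker.mpr h)
    obtain ⟨hle, hrank, htriv, -⟩ := selQP_lower_of_detected W K p c hK hp hc1 hqm hx hv hvx
    exact ⟨hle, hrank, htriv⟩
  · -- signed Čebotarev: a detecting prime outside `B`; its sign is that of the detected class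
    obtain ⟨q, hqB, v, hv, hxv⟩ := exists_admQ_notMem_torsionLocalKer W K p c h5 hadd hsurj hK hH hc1 hx hx0 B
    refine ⟨q, hqB, ?_, fun hall ↦ hxv (hall v hv)⟩
    by_contra hne
    have hμ : μ = !ε q := by
      revert hne
      cases μ <;> cases ε q <;> decide
    exact hxv (hInertT q x (hμ ▸ conjAct_eq_of_mem_selQP W K p c m μ hx) v hv)

/-! ## §3 KS′'s conclusion at a ♯ frame from a bipartite datum, ONE seed at a core level, (R′) and odd bottom rank -/

variable [NeZero (W.conductorNorm ℤ)] (Dt : ModularParametrizationData W (W.conductorNorm ℤ)) (β : ℤ) (ι : K →+* ℂ)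

/-- **KS′'s conclusion at a ♯ additive frame from a BIPARTITE datum, ONE SEED at a core level, witness-free ONE-PRIME
RAISING (R′) and ODD bottom rank** — part 3's `nonempty_levelKolyvaginSystemP_of_bipartite_of_seed` with its `connected`
binder DISCHARGED by `selQP_coreConnected`. Compared with w2's `nonempty_levelKolyvaginSystemP_of_bipartite_at_frame`: the
rank-0 ANCHOR (γ) «`Sel_{n'} = 0 ⟹ λ(∅, n') ≠ 0`» AT EVERY ODD LEVEL (the unprinted Skinner–Urban-type input at `p² ∣ N`,
DEAD-LINES D2/D3) is REPLACED by ONE seed (a non-zero conductor-one class at an even level of total rank `≤ 1`, OR one unit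
value at an odd level of total rank `0` — one special value, or one computed class) + (R′) (Poitou–Tate at one relaxed
admissible place; E-side) + the parity of `dim Sel_p(E/K)` (odd at `r_an = 1` frames; `= 1` in the BOT′ regime); the laws
(A), (B) are asked two-sidedly (BD05 Thms 4.2 ∕ 4.1 are equalities up to units). CONDITIONAL; closes nothing; BSD is not
proved by this. [cite: Howard2006Bipartite, Prop. 2.4.11, Thm. 2.5.1] [cite: WZhang2014, Thm. 4.3, (4.8), Lemma 5.3,
Prop. 5.4, Thm. 7.2, Lemma 7.3, §9] [cite: BertoliniDarmon2005, Thm. 3.2, Thm. 4.1, Thm. 4.2] -/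
theorem nonempty_levelKolyvaginSystemP_of_bipartite_of_seed_at_frame (h5 : 5 ≤ p) (hadd : Addv W p)
    (hsurj : W.HasSurjectiveModNGaloisRep p) (hK : IsImaginaryQuadratic K)
    (hH : SatisfiesHeegnerHypothesis (W.conductorNorm ℤ) K) (hc1 : c ≠ 1)
    (ε₀ : Finset (AdmQ W K p) → Bool)
    (κ₀ : Finset {ℓ // Zhang2014.IsKolyvaginPrime (W.conductorNorm ℤ) W K p ℓ} → Finset (AdmQ W K p) → Vp W K p)
    (lam : Finset {ℓ // Zhang2014.IsKolyvaginPrime (W.conductorNorm ℤ) W K p ℓ} → Finset (AdmQ W K p) → ZMod p)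
    (realisation : ∀ m : Finset {ℓ // Zhang2014.IsKolyvaginPrime (W.conductorNorm ℤ) W K p ℓ},
      ∃ d : KolyvaginHeegnerData Dt β ι (∏ ℓ ∈ m, (ℓ : ℕ)), κ₀ m ∅ = d.kolyvaginClass (Fact.out : p.Prime) 1)
    (sign : ∀ n : Finset (AdmQ W K p), n.Nonempty → Even n.card →
      ∀ m : Finset {ℓ // Zhang2014.IsKolyvaginPrime (W.conductorNorm ℤ) W K p ℓ},
      conjAct W c ((p ^ 1 : ℕ) : ℤ) (κ₀ m n) = sgnP (ε₀ n ^^ Nat.bodd m.card) • κ₀ m n)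
    (selmer_off : ∀ n : Finset (AdmQ W K p), n.Nonempty → Even n.card →
      ∀ (m : Finset {ℓ // Zhang2014.IsKolyvaginPrime (W.conductorNorm ℤ) W K p ℓ}) (v : HeightOneSpectrum (𝓞 K)),
      (∀ ℓ ∈ m, ((ℓ : ℕ) : 𝓞 K) ∉ v.asIdeal) → (∀ q ∈ n, ((q : ℕ) : 𝓞 K) ∉ v.asIdeal) →
      κ₀ m n ∈ selmerLocalKer (W.baseChange K) (v.adicCompletion K) ((p ^ 1 : ℕ) : ℤ))
    (selmer_inf : ∀ n : Finset (AdmQ W K p), n.Nonempty → Even n.card →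
      ∀ (m : Finset {ℓ // Zhang2014.IsKolyvaginPrime (W.conductorNorm ℤ) W K p ℓ}) (w : InfinitePlace K),
      κ₀ m n ∈ selmerLocalKer (W.baseChange K) w.Completion ((p ^ 1 : ℕ) : ℤ))
    (toric_on : ∀ n : Finset (AdmQ W K p), n.Nonempty → Even n.card →
      ∀ m : Finset {ℓ // Zhang2014.IsKolyvaginPrime (W.conductorNorm ℤ) W K p ℓ}, ∀ q ∈ n,
      ∀ v : HeightOneSpectrum (𝓞 K),
      ((q : ℕ) : 𝓞 K) ∈ v.asIdeal → κ₀ m n ∈ toricLocalKer (W.baseChange K) (v.adicCompletion K) ((p ^ 1 : ℕ) : ℤ))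
    (transverse_on : ∀ n : Finset (AdmQ W K p), n.Nonempty → Even n.card →
      ∀ m : Finset {ℓ // Zhang2014.IsKolyvaginPrime (W.conductorNorm ℤ) W K p ℓ}, ∀ ℓ ∈ m,
      ∀ v : HeightOneSpectrum (𝓞 K),
      ((ℓ : ℕ) : 𝓞 K) ∈ v.asIdeal → κ₀ m n ∈ transverseLocalKerP W K p ι ℓ v)
    (relation : ∀ n : Finset (AdmQ W K p), n.Nonempty → Even n.card →
      ∀ (m : Finset {ℓ // Zhang2014.IsKolyvaginPrime (W.conductorNorm ℤ) W K p ℓ})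
        (ℓ : {ℓ // Zhang2014.IsKolyvaginPrime (W.conductorNorm ℤ) W K p ℓ}), ℓ ∉ m → ∀ v : HeightOneSpectrum (𝓞 K),
      ((ℓ : ℕ) : 𝓞 K) ∈ v.asIdeal →
      (κ₀ (insert ℓ m) n ∈ (W.baseChange K).torsionLocalKer (v.adicCompletion K) ((p ^ 1 : ℕ) : ℤ) ↔
        κ₀ m n ∈ (W.baseChange K).torsionLocalKer (v.adicCompletion K) ((p ^ 1 : ℕ) : ℤ)))
    (lawA : ∀ (n : Finset (AdmQ W K p)) (q : AdmQ W K p), Even n.card → q ∉ n →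
      ∀ m : Finset {ℓ // Zhang2014.IsKolyvaginPrime (W.conductorNorm ℤ) W K p ℓ},
      lam m (insert q n) ≠ 0 ↔ ∃ v : HeightOneSpectrum (𝓞 K), ((q : ℕ) : 𝓞 K) ∈ v.asIdeal ∧
        κ₀ m n ∉ (W.baseChange K).torsionLocalKer (v.adicCompletion K) ((p ^ 1 : ℕ) : ℤ))
    (lawB : ∀ (n : Finset (AdmQ W K p)) (q : AdmQ W K p), Odd n.card → q ∉ n →
      ∀ m : Finset {ℓ // Zhang2014.IsKolyvaginPrime (W.conductorNorm ℤ) W K p ℓ},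
      (∃ v : HeightOneSpectrum (𝓞 K), ((q : ℕ) : 𝓞 K) ∈ v.asIdeal ∧
        κ₀ m (insert q n) ∉ (W.baseChange K).torsionLocalKer (v.adicCompletion K) ((p ^ 1 : ℕ) : ℤ)) ↔ lam m n ≠ 0)
    (selmer_bottom : ∃ μ : Bool, κ₀ ∅ ∅ ∈ SelQP W K p c ∅ μ)
    (n₀ : Finset (AdmQ W K p))
    (hcore₀ : finrank (ZMod p) (SelQP W K p c n₀ true) + finrank (ZMod p) (SelQP W K p c n₀ false) ≤ 1)
    (seed : (Even n₀.card ∧ κ₀ ∅ n₀ ≠ 0) ∨ (Odd n₀.card ∧ lam ∅ n₀ ≠ 0))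
    (hraise : ∀ (m : Finset (AdmQ W K p)) (q : AdmQ W K p) (μ : Bool), q ∉ m →
      (∀ v : HeightOneSpectrum (𝓞 K), ((q : ℕ) : 𝓞 K) ∈ v.asIdeal → ∀ z : Vp W K p,
        (W.baseChange K).torsionLocMap (v.adicCompletion K) ((p ^ 1 : ℕ) : ℤ) (conjAct W c ((p ^ 1 : ℕ) : ℤ) z) =
          sgnP μ • (W.baseChange K).torsionLocMap (v.adicCompletion K) ((p ^ 1 : ℕ) : ℤ) z) →
      (∀ x ∈ SelQP W K p c m μ, ∀ v : HeightOneSpectrum (𝓞 K), ((q : ℕ) : 𝓞 K) ∈ v.asIdeal →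
        x ∈ (W.baseChange K).torsionLocalKer (v.adicCompletion K) ((p ^ 1 : ℕ) : ℤ)) →
      SelQP W K p c m μ ≤ SelQP W K p c (insert q m) μ ∧
        finrank (ZMod p) (SelQP W K p c (insert q m) μ) = finrank (ZMod p) (SelQP W K p c m μ) + 1)
    (hodd : Odd (finrank (ZMod p) (SelQP W K p c ∅ true) + finrank (ZMod p) (SelQP W K p c ∅ false))) :
    Nonempty (LevelKolyvaginSystemP W K p Dt β ι c) :=
  nonempty_levelKolyvaginSystemP_of_bipartite_of_seed W K p c Dt β ι ε₀ κ₀ lam realisation sign selmer_off selmer_inf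
    toric_on transverse_on relation lawA lawB selmer_bottom n₀ seed
    (selQP_coreConnected W K p c h5 hadd hsurj hK hH hc1 hraise hodd hcore₀)

end Connected

end Summit.BirchSwinnertonDyer.BirchSwinnertonDyer.Theorems.AdditiveKoly

end
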